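import Literature.Analysis.FluidPDE.WeylLemmaBall
import HarnessLib

/-!
# Weyl's lemma on a ball for the Poisson equation with smooth right-hand side

Analysis/FluidPDE support file (everything proved, no definitions, no named facts); the
inhomogeneous companion of `WeylLemmaBall` (`ae_eq_newtonFarSmoothing_indicator`: an `L¹` function
which is *weakly harmonic* on a ball agrees a.e. on a smaller ball with a smooth function). Here the
weak equation is `Δ H = f` with a *smooth* right-hand side: if `H ∈ L¹(B(c, R))` satisfies
`∫_B H Δφ = ∫_B f φ` for all `φ ∈ C_c^∞(B(c, R))`, `f ∈ C^∞(ℝ³)`, then on `B(c, R - r₁)`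

  `H = Λ[1_B H] + N[f]`  a.e.,

with the tree's truncated Newtonian potential `N[g] = Γ₀ ⋆ g` and smoothing `Λ[g] = λ ⋆ g` at radii
`(r₀, r₁)` (`FluidPDE/NewtonLocalPotential`): testing against `φ ∈ C_c^∞(B(c, R - r₁))`,
`∫ φ Λ[1_B H] = ∫_B H Λ[φ] = ∫_B H φ - ∫_B H ΔN[φ] = ∫_B H φ - ∫_B f N[φ]` by Green's
representation `ΔN[φ] = φ - Λ[φ]` and the weak equation (`N[φ] ∈ C_c^∞(B(c, R))`), and
`∫_B f N[φ] = ∫ N[1_B f] φ = ∫ N[f] φ` because `N` is symmetric (`Γ₀` is even) and local (the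
kernel lives in `|z| ≤ r₁`). Both summands are smooth, so `H` has a `C^∞` representative on the
smaller ball (Weyl 1940, Lemma 2, for the Poisson equation; the classical interior regularity of
distributional solutions of `Δu = f`, e.g. Gilbarg–Trudinger, proof of Thm. 9.19 / §2.6). This is
the interior-regularity input of the weak periodic Neumann problem on the cylinder
(`PeriodicCylinderNeumannInterior`).

* `integral_mul_newtonNearPotential` — `∫ φ N[G] = ∫ G N[φ]` for
  `G ∈ L¹` and continuous compactly supported `φ` (Fubini; the product integrand is integrable by
  `Integrable.convolution_integrand`);
* `newtonNearPotential_indicator_ball` — `N[1_{B(c,R)} f] = N[f]` on `B(c, R - r₁)`;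
* `contDiff_newtonFarSmoothing_of_integrable` — `Λ[G] ∈ C^∞` for `G ∈ L¹`;
* `ae_eq_of_weakPoisson_ball`, `exists_contDiff_rep_of_weakPoisson_ball` — the statements above.

## Mathlib / tree search

Tree (all used): `WeylLemmaBall.integral_mul_newtonFarSmoothing`,
`WeylLemmaBall.isTestFunctionOn_newtonNearPotential`, `laplacian_newtonNearPotential`,
`contDiff_newtonNearPotential_top`, `integrable_newtonNear`, `newtonNear_eq_zero`,
`contDiff_newtonFarLaplacian`, `hasCompactSupport_newtonFarLaplacian` (`NewtonKernel`,
`NewtonPotential`, `NewtonLocalPotential`, `WeylLemmaBall`). Mathlib: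
`Integrable.convolution_integrand`, `integral_integral_swap`,
`IsOpen.ae_eq_zero_of_integral_contDiff_smul_eq_zero`, `HasCompactSupport.contDiff_convolution_left`.
`lean search 'weakPoisson|Poisson.*Weyl|weyl.*inhomog'`: nothing.

## References

* H. Weyl, *The method of orthogonal projection in potential theory*, Duke Math. J. 7 (1940),
  411–444, Lemma 2.
* D. Gilbarg, N. S. Trudinger, *Elliptic Partial Differential Equations of Second Order* (2001),
  (2.16)–(2.17), §2.6. [GilbargTrudinger2001]
-/

noncomputable section

open MeasureTheory Set Function Filter Topology TopologicalSpace Metric InnerProductSpace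
  ContinuousLinearMap
open scoped ENNReal NNReal Convolution ContDiff Laplacian

namespace Literature.Analysis.FluidPDE

namespace WeylLemmaBall

/-- Local notation for physical space `ℝ³ = EuclideanSpace ℝ (Fin 3)`. -/
local notation "ℝ³" => EuclideanSpace ℝ (Fin 3)

variable {r₀ r₁ : ℝ}

/-! ### The truncated kernel is even; the truncated potential is symmetric and local -/

/-- `Γ₀` is even (it is a radial function; file-local copy of the tree's `newtonNear_neg` of
`TruncatedNewtonHessian`, kept private to avoid the heavier import and a public duplicate). [folklore] -/
private theorem newtonNear_neg_aux (r₀ r₁ : ℝ) (z : ℝ³) : newtonNear r₀ r₁ (-z) = newtonNear r₀ r₁ z := by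
  rw [newtonNear, newtonNear, radialCutoff_radial r₀ r₁ (norm_neg z), newtonKernel, newtonKernel, norm_neg]

/-- **`∫ φ N[G] = ∫ G N[φ]`** for `G ∈ L¹` and a continuous compactly supported `φ` (Fubini: the
integrand `φ(x) G(y) Γ₀(x − y)` is integrable on `ℝ³ × ℝ³` because `Γ₀, G ∈ L¹` and `φ` is bounded;
`Γ₀` is even). [folklore] -/
theorem integral_mul_newtonNearPotential (h₀ : 0 ≤ r₀) (h₁ : r₀ < r₁) {G : ℝ³ → ℝ}
    (hG : Integrable G) {φ : ℝ³ → ℝ} (hφ : Continuous φ) (hφc : HasCompactSupport φ) :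
    ∫ x, φ x * newtonNearPotential r₀ r₁ G x = ∫ y, G y * newtonNearPotential r₀ r₁ φ y := by
  set K := newtonNear r₀ r₁ with hK
  have hKi : Integrable K := integrable_newtonNear h₀ h₁
  obtain ⟨C, hC⟩ := hφ.bounded_above_of_compact_support hφc
  -- the integrand on the product space and its integrability
  set Φ : ℝ³ → ℝ³ → ℝ := fun x y => φ x * (G y * K (x - y)) with hΦ
  have hI0 : Integrable (fun p : ℝ³ × ℝ³ => G p.2 * K (p.1 - p.2)) (volume.prod volume) := by
    have h := hG.convolution_integrand (ContinuousLinearMap.mul ℝ ℝ) hKi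
    simpa only [ContinuousLinearMap.mul_apply'] using h
  have hΦi : Integrable (uncurry Φ) (volume.prod volume) := by
    have h := hI0.bdd_mul ((hφ.comp continuous_fst).aestronglyMeasurable) (Eventually.of_forall fun p => hC p.1)
    refine h.congr (Eventually.of_forall fun p => ?_)
    rcases p with ⟨x, y⟩
    rfl
  -- Fubini
  have hL : ∫ x, φ x * newtonNearPotential r₀ r₁ G x = ∫ x, ∫ y, Φ x y := by
    refine integral_congr_ae (Eventually.of_forall fun x => ?_)
    simp only [hΦ]
    rw [newtonNearPotential_apply, ← integral_const_mul]
    have e := integral_sub_left_eq_self (fun z => φ x * (K z * G (x - z))) volume x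
    rw [← e]
    refine integral_congr_ae (Eventually.of_forall fun y => ?_)
    simp only [sub_sub_cancel]
    ring
  have hR : ∫ y, G y * newtonNearPotential r₀ r₁ φ y = ∫ y, ∫ x, Φ x y := by
    refine integral_congr_ae (Eventually.of_forall fun y => ?_)
    simp only [hΦ]
    rw [newtonNearPotential_apply, ← integral_const_mul]
    have e := integral_sub_left_eq_self (fun z => G y * (K z * φ (y - z))) volume y
    rw [← e]
    refine integral_congr_ae (Eventually.of_forall fun x => ?_)
    simp only [sub_sub_cancel]
    rw [show y - x = -(x - y) by abel, hK, newtonNear_neg_aux]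
    ring
  rw [hL, hR]
  exact integral_integral_swap hΦi

/-- **Locality of the truncated potential on a ball**: `N[1_{B(c,R)} f] = N[f]` on `B(c, R − r₁)`
(the kernel lives in `|z| ≤ r₁`). [folklore] -/
theorem newtonNearPotential_indicator_ball (h₀ : 0 ≤ r₀) (h₁ : r₀ < r₁) {c : ℝ³} {R : ℝ} (f : ℝ³ → ℝ)
    {x : ℝ³} (hx : x ∈ ball c (R - r₁)) :
    newtonNearPotential r₀ r₁ ((ball c R).indicator f) x = newtonNearPotential r₀ r₁ f x := by
  simp only [newtonNearPotential_apply]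
  refine integral_congr_ae (Eventually.of_forall fun z => ?_)
  show newtonNear r₀ r₁ z * (ball c R).indicator f (x - z) = newtonNear r₀ r₁ z * f (x - z)
  by_cases hz : ‖z‖ ≤ r₁
  · rw [indicator_of_mem]
    rw [mem_ball] at hx ⊢
    calc dist (x - z) c ≤ dist (x - z) x + dist x c := dist_triangle _ _ _
      _ = ‖z‖ + dist x c := by rw [dist_eq_norm, sub_sub_cancel_left, norm_neg]
      _ < R := by linarith
  · rw [newtonNear_eq_zero h₀ h₁ (not_le.1 hz).le, zero_mul, zero_mul]

/-- `Λ[G]` is smooth for `G ∈ L¹` (`λ` is smooth with compact support). [folklore] -/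
theorem contDiff_newtonFarSmoothing_of_integrable (h₀ : 0 < r₀) (h₁ : r₀ < r₁) {G : ℝ³ → ℝ}
    (hG : Integrable G) {n : ℕ∞} : ContDiff ℝ n (newtonFarSmoothing r₀ r₁ G) := by
  rw [newtonFarSmoothing_eq_convolution]
  exact (hasCompactSupport_newtonFarLaplacian h₀.le h₁).contDiff_convolution_left _
    (contDiff_newtonFarLaplacian h₀ h₁) hG.locallyIntegrable

/-! ### Weyl's lemma for the Poisson equation -/

/-- **Weyl's lemma on a ball for `ΔH = f`, representative form.** If `H ∈ L¹(B(c, R))` satisfies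
`∫_B H Δφ = ∫_B f φ` for all `φ ∈ C_c^∞(B(c, R))`, with `f ∈ C^∞(ℝ³)`, then
`H = Λ[1_B H] + N[f]` a.e. on `B(c, R - r₁)`: for `φ ∈ C_c^∞(B(c, R - r₁))`,
`∫ φ Λ[1_B H] = ∫_B H Λ[φ] = ∫_B H φ - ∫_B H ΔN[φ] = ∫_B H φ - ∫_B f N[φ]` (Green's representation
`ΔN[φ] = φ - Λ[φ]`, the weak equation with the test function `N[φ] ∈ C_c^∞(B(c, R))`), while
`∫ φ N[f] = ∫ φ N[1_B f] = ∫_B f N[φ]` (locality and symmetry of `N`); the fundamental lemma of the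
calculus of variations concludes. [folklore] -/
theorem ae_eq_of_weakPoisson_ball (h₀ : 0 < r₀) (h₁ : r₀ < r₁) {c : ℝ³} {R : ℝ}
    {H : ℝ³ → ℝ} (hH : IntegrableOn H (ball c R) volume) {f : ℝ³ → ℝ} (hf : ContDiff ℝ ∞ f)
    (hweak : ∀ φ : ℝ³ → ℝ,
      FunctionSpaces.IsTestFunctionOn (⟨ball c R, isOpen_ball⟩ : Opens ℝ³) φ →
        ∫ x in ball c R, H x * (Δ φ) x = ∫ x in ball c R, f x * φ x) :
    H =ᵐ[volume.restrict (ball c (R - r₁))]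
      fun x => newtonFarSmoothing r₀ r₁ ((ball c R).indicator H) x + newtonNearPotential r₀ r₁ f x := by
  set G : ℝ³ → ℝ := (ball c R).indicator H with hGdef
  have hG : Integrable G := hH.integrable_indicator measurableSet_ball
  set S := newtonFarSmoothing r₀ r₁ G with hS
  have hSc : Continuous S := continuous_newtonFarSmoothing' h₀ h₁ hG
  set P := newtonNearPotential r₀ r₁ f with hP
  have hPc : Continuous P := (contDiff_newtonNearPotential_top h₀.le h₁ hf).continuous
  have hfi : IntegrableOn f (ball c R) volume :=
    (hf.continuous.continuousOn.integrableOn_compact (isCompact_closedBall c R)).mono_set ball_subset_closedBall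
  set Gf : ℝ³ → ℝ := (ball c R).indicator f with hGfdef
  have hGf : Integrable Gf := hfi.integrable_indicator measurableSet_ball
  set U : Set ℝ³ := ball c (R - r₁) with hU
  -- the difference `S + P - G` is annihilated by every test function on `U`
  have hLI : LocallyIntegrableOn (fun x => (S x + P x) - G x) U volume :=
    (((hSc.add hPc).locallyIntegrable).sub hG.locallyIntegrable).locallyIntegrableOn U
  have hkey : ∀ φ : ℝ³ → ℝ, ContDiff ℝ ∞ φ → HasCompactSupport φ → tsupport φ ⊆ U →
      ∫ x, φ x • ((S x + P x) - G x) = 0 := by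
    intro φ hφ hφc hφU
    have hφT : FunctionSpaces.IsTestFunctionOn (⟨ball c (R - r₁), isOpen_ball⟩ : Opens ℝ³) φ :=
      ⟨hφ, hφc, hφU⟩
    have hφ2 : ContDiff ℝ 2 φ := hφ.of_le (by norm_cast)
    have hφcont : Continuous φ := hφ.continuous
    obtain ⟨Cφ, hCφ⟩ := hφcont.bounded_above_of_compact_support hφc
    -- `N[φ]` is a test function on `B(c, R)`
    have hN : FunctionSpaces.IsTestFunctionOn (⟨ball c R, isOpen_ball⟩ : Opens ℝ³)
        (newtonNearPotential r₀ r₁ φ) :=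
      isTestFunctionOn_newtonNearPotential h₀.le h₁ (by linarith) hφT
    have hΔN : Continuous (Δ (newtonNearPotential r₀ r₁ φ)) :=
      continuous_laplacian (hN.contDiff.of_le (by norm_cast))
    have hΔNc : HasCompactSupport (Δ (newtonNearPotential r₀ r₁ φ)) :=
      hN.hasCompactSupport.mono' fun x hx => by
        by_contra h
        exact hx (laplacian_eq_zero_of_notMem_tsupport h)
    obtain ⟨CΔ, hCΔ⟩ := hΔN.bounded_above_of_compact_support hΔNc
    -- the weak Poisson identity tested with `N[φ]`
    have hpoisson : ∫ y, G y * (Δ (newtonNearPotential r₀ r₁ φ)) y =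
        ∫ y, Gf y * newtonNearPotential r₀ r₁ φ y := by
      have h := hweak _ hN
      rw [← integral_indicator measurableSet_ball, ← integral_indicator measurableSet_ball] at h
      have e1 : (fun y => G y * (Δ (newtonNearPotential r₀ r₁ φ)) y) =
          (ball c R).indicator (fun y => H y * (Δ (newtonNearPotential r₀ r₁ φ)) y) := by
        funext y; simp only [hGdef]; exact (indicator_mul_left _ _ _).symm
      have e2 : (fun y => Gf y * newtonNearPotential r₀ r₁ φ y) =
          (ball c R).indicator (fun y => f y * newtonNearPotential r₀ r₁ φ y) := by
        funext y; simp only [hGfdef]; exact (indicator_mul_left _ _ _).symm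
      rw [e1, e2]
      exact h
    -- integrability of the pieces
    have hI1 : Integrable fun x => φ x * S x :=
      (hφcont.mul hSc).integrable_of_hasCompactSupport hφc.mul_right
    have hI1' : Integrable fun x => φ x * P x :=
      (hφcont.mul hPc).integrable_of_hasCompactSupport hφc.mul_right
    have hI2 : Integrable fun x => φ x * G x :=
      hG.bdd_mul hφcont.aestronglyMeasurable (Eventually.of_forall hCφ)
    have hI3 : Integrable fun y => G y * φ y :=
      hG.mul_bdd hφcont.aestronglyMeasurable (Eventually.of_forall hCφ)
    have hI4 : Integrable fun y => G y * (Δ (newtonNearPotential r₀ r₁ φ)) y :=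
      hG.mul_bdd hΔN.aestronglyMeasurable (Eventually.of_forall hCΔ)
    -- `∫ φ S = ∫ G φ − ∫ Gf N[φ]`
    have h1 : ∫ x, φ x * S x = (∫ y, G y * φ y) - ∫ y, Gf y * newtonNearPotential r₀ r₁ φ y := by
      rw [hS, integral_mul_newtonFarSmoothing h₀ h₁ hG hφcont hφc]
      have hΛ : ∀ y, newtonFarSmoothing r₀ r₁ φ y =
          φ y - (Δ (newtonNearPotential r₀ r₁ φ)) y := fun y => by
        rw [laplacian_newtonNearPotential h₀ h₁ hφ2 y]; ring
      simp_rw [hΛ, mul_sub]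
      rw [integral_sub hI3 hI4, hpoisson]
    -- `∫ φ P = ∫ Gf N[φ]` (locality and symmetry of `N`)
    have h2 : ∫ x, φ x * P x = ∫ y, Gf y * newtonNearPotential r₀ r₁ φ y := by
      rw [← integral_mul_newtonNearPotential h₀.le h₁ hGf hφcont hφc]
      refine integral_congr_ae (Eventually.of_forall fun x => ?_)
      show φ x * P x = φ x * newtonNearPotential r₀ r₁ Gf x
      by_cases hx : x ∈ U
      · rw [hP, hGfdef, newtonNearPotential_indicator_ball h₀.le h₁ f hx]
      · have : φ x = 0 := image_eq_zero_of_notMem_tsupport fun h => hx (hφU h)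
        rw [this, zero_mul, zero_mul]
    have e3 : ∫ x, φ x * G x = ∫ y, G y * φ y :=
      integral_congr_ae (Eventually.of_forall fun x => mul_comm _ _)
    have hI12 : Integrable fun x => φ x * S x + φ x * P x := hI1.add hI1'
    simp_rw [smul_eq_mul, mul_sub, mul_add]
    rw [integral_sub hI12 hI2, integral_add hI1 hI1', h1, h2, e3]
    ring
  have hae := isOpen_ball.ae_eq_zero_of_integral_contDiff_smul_eq_zero hLI hkey
  -- translate to the restricted measure
  rw [EventuallyEq, ae_restrict_iff' measurableSet_ball]
  filter_upwards [hae] with x hx hxU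
  have hxB : x ∈ ball c R := ball_subset_ball (by linarith) hxU
  have hGx : G x = H x := by rw [hGdef, indicator_of_mem hxB]
  have := hx hxU
  rw [← hGx]
  linarith

/-- **Weyl's lemma on a ball for `ΔH = f`: a smooth representative.** Under the hypotheses of
`ae_eq_of_weakPoisson_ball` (with any `r₁ > 0`), `H` agrees a.e. on `B(c, R - r₁)` with a
function which is `C^∞` on all of `ℝ³`. [folklore] -/
theorem exists_contDiff_rep_of_weakPoisson_ball (h₁ : 0 < r₁) {c : ℝ³} {R : ℝ}
    {H : ℝ³ → ℝ} (hH : IntegrableOn H (ball c R) volume) {f : ℝ³ → ℝ} (hf : ContDiff ℝ ∞ f)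
    (hweak : ∀ φ : ℝ³ → ℝ,
      FunctionSpaces.IsTestFunctionOn (⟨ball c R, isOpen_ball⟩ : Opens ℝ³) φ →
        ∫ x in ball c R, H x * (Δ φ) x = ∫ x in ball c R, f x * φ x) :
    ∃ g : ℝ³ → ℝ, ContDiff ℝ ∞ g ∧ H =ᵐ[volume.restrict (ball c (R - r₁))] g :=
  ⟨_, (contDiff_newtonFarSmoothing_of_integrable (half_pos h₁) (half_lt_self h₁)
      (hH.integrable_indicator measurableSet_ball)).add
      (contDiff_newtonNearPotential_top (half_pos h₁).le (half_lt_self h₁) hf),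
    ae_eq_of_weakPoisson_ball (half_pos h₁) (half_lt_self h₁) hH hf hweak⟩

end WeylLemmaBall

end Literature.Analysis.FluidPDE
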